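import Summits.QuantumFields.YangMills.Theorems.AllWindowsColdBoxBoxHighLineConnectedFourPointPrelims

/-!
# `ConnectedFourPoint`, cubic pair — per-pair estimate in the edge chart: two centred `|ℓ^c|²`'s against two `tripleForm` vertices

LEAD seat `ym-line-sfw-p2` (g78), cell ym-idea-1; U5 prep, helper-grade (`U5-BLOCKERS.md` §2 lift L3: «`f″(0) = κ₄,₀(c₀,c_T,U,U)` evaluated EXACTLY
(connected 4-point diagrams at the Gaussian)»).  By parity and crude Hölder every piece of `κ₄,₀` except the CUBIC PAIR is already small; the cubic pair is
`κ₄(L̃₀, L̃_T, V₃, V₃) = E₀[L̃₀L̃_T V₃²] − E₀[L̃₀L̃_T]E₀[V₃²]` with `V₃ = β Σ_p tripleForm_p + O(‖a‖⁵)` (✓T-S5.7a) and `L = Σ_c |ℓ^c|²`.  This file proves the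
PER-PAIR, PER-COLOUR estimate behind it, in the chart letters of ✓`…Step2Wick`:

★★ `abs_connected_linCurvSq_tripleForm_pair_le` — for `H ≥ 1`, `β > 0`, base points `x₀, x_T` (observables `ℓ^{c₀}_{plaq12At x₀}`, `ℓ^{c_T}_{plaq12At x_T}`),
vertices `tripleForm T (plaqVar_{(x,μ,ν)})`, `tripleForm T' (plaqVar_{(y,μ',ν')})` with `|T|, |T'| ≤ B`, and PROPAGATOR BOUNDS between the free edges of the four
plaquettes (`m₀`: `x₀ ↔ x_T`, `ax`: `x₀ ↔ x`, `ay`: `x₀ ↔ y`, `bx`: `x_T ↔ x`, `by`: `x_T ↔ y`, `Mxy`: `x ↔ y`, all in the shape of ✓`cross_propagator_le`),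

  `|E₀[:A²::B²:·tF·tF'] − E₀[:A²::B²:]·E₀[tF·tF']| ≤ (384B)²·(864·(16m₀)·Mxy²·Σ + 324·Mxy·Σ²)`,  `Σ := 4ax·4by + 4ay·4bx`,

`A = linCurv H (plaq12At x₀) · c₀`, `:A²: = A² − E₀[A²]`, `E₀ = gaussAvg β H`.  Route: ✓`gaussAvg_eq_integral_pi` (transfer to the legs process under `P_β`),
✓`tripleForm_plaqVar_expansion` (each vertex = `Σ_k c_k ·` three colour-distinct coordinate legs, `Σ|c_k| ≤ 384B`), ✓7e `quadFormSplit` (`A` = signed sum of at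
most four coordinate legs), and per monomial pair ✓`WickTwoPairs.abs_connected_wick22_twoVertex_le` (one-line and no-line connected diagrams; same-side
attachments vanish).  With ✓S3b (`cross_propagator_le`: every bound `~ (2β)⁻¹(1+log H)/(1+d)²`) and ✓`cubeTwoCentreSums` the sum over `p, p′, c₀, c_T` is
`≲ (1+log H)⁷/β³` — RELATIVE `H⁸·polylog/β` against the main term on the bulk window (8θ < 1), replacing B3's Cauchy–Schwarz `H¹²/β` (next file).

Tree only (✓GaussAvgTransfer, ✓WickTwoPairsSides, ✓TripleBond chain, ✓QuadFormSplit) + Mathlib; no definitions; standard axioms.  HONEST LABEL: one brick of the RECORDED lift L3 of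
the NEXT rung U5 (⟨stmt-QuantumFields-24336⟩, UNSTAFFED); ⟨24004⟩ ⟨24336⟩ and this seat's crux ⟨stmt-QuantumFields-22884⟩ remain OPEN; route AllWindowsColdBox is DRAFT; no
crux, rung or summit is proved; **the Yang–Mills mass gap is NOT proved by this file; no summit is proved by a line.**
-/

set_option autoImplicit false

noncomputable section

open MeasureTheory ProbabilityTheory Matrix Finset
open scoped Kronecker
open Literature.Probability.LatticeModels (Site)
open Literature.MathematicalPhysics.QuantumLattice (ZdPlaquette plaquettesTouching)
open Summit.QuantumFields.YangMills.Theorems.WeakCouplingRates (plaq12At)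

namespace Summit.QuantumFields.YangMills.Theorems.AllWindowsColdBoxBoxHighLine

namespace EdgeChartGaussian

open LaplaceSandwich (flatten flatten_apply flatten_symm_apply)
open GaussianChartWick WickTwoPairs
open Literature.Probability.Distributions.GaussianWick

/-- ★★ **`ConnectedFourPoint`, CUBIC PAIR, PER PAIR AND PER COLOUR** (see the module docstring for the letters). -/
theorem abs_connected_linCurvSq_tripleForm_pair_le (H : ℕ) (hH : 1 ≤ H) {β : ℝ} (hβ : 0 < β) {B : ℝ}
    (T T' : Fin 4 → Fin 4 → Fin 4 → ℝ) (hT : ∀ i j k, |T i j k| ≤ B) (hT' : ∀ i j k, |T' i j k| ≤ B)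
    (x₀ x_T x y : Site 4) (μ ν μ' ν' : Fin 4) (c₀ c_T : Fin 3) {m₀ ax ay bx by_ Mxy : ℝ}
    (hm₀0 : 0 ≤ m₀) (hax0 : 0 ≤ ax) (hay0 : 0 ≤ ay) (hbx0 : 0 ≤ bx) (hby0 : 0 ≤ by_) (hMxy : 0 ≤ Mxy)
    (hm₀ : ∀ (e e' : LandauFree H) (i i' : Fin 4),
      (e.1.1 : Literature.MathematicalPhysics.QuantumLattice.ZdEdge 4) = plaqEdge x₀ 1 2 i →
      (e'.1.1 : Literature.MathematicalPhysics.QuantumLattice.ZdEdge 4) = plaqEdge x_T 1 2 i' →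
      ∀ c c' : Fin 3, |(2 * β)⁻¹ * (if c = c' then (hodgeQ H)⁻¹ e e' else 0)| ≤ m₀)
    (hax : ∀ (e e' : LandauFree H) (i i' : Fin 4),
      (e.1.1 : Literature.MathematicalPhysics.QuantumLattice.ZdEdge 4) = plaqEdge x₀ 1 2 i →
      (e'.1.1 : Literature.MathematicalPhysics.QuantumLattice.ZdEdge 4) = plaqEdge x μ ν i' →
      ∀ c c' : Fin 3, |(2 * β)⁻¹ * (if c = c' then (hodgeQ H)⁻¹ e e' else 0)| ≤ ax)
    (hay : ∀ (e e' : LandauFree H) (i i' : Fin 4),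
      (e.1.1 : Literature.MathematicalPhysics.QuantumLattice.ZdEdge 4) = plaqEdge x₀ 1 2 i →
      (e'.1.1 : Literature.MathematicalPhysics.QuantumLattice.ZdEdge 4) = plaqEdge y μ' ν' i' →
      ∀ c c' : Fin 3, |(2 * β)⁻¹ * (if c = c' then (hodgeQ H)⁻¹ e e' else 0)| ≤ ay)
    (hbx : ∀ (e e' : LandauFree H) (i i' : Fin 4),
      (e.1.1 : Literature.MathematicalPhysics.QuantumLattice.ZdEdge 4) = plaqEdge x_T 1 2 i →
      (e'.1.1 : Literature.MathematicalPhysics.QuantumLattice.ZdEdge 4) = plaqEdge x μ ν i' →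
      ∀ c c' : Fin 3, |(2 * β)⁻¹ * (if c = c' then (hodgeQ H)⁻¹ e e' else 0)| ≤ bx)
    (hby : ∀ (e e' : LandauFree H) (i i' : Fin 4),
      (e.1.1 : Literature.MathematicalPhysics.QuantumLattice.ZdEdge 4) = plaqEdge x_T 1 2 i →
      (e'.1.1 : Literature.MathematicalPhysics.QuantumLattice.ZdEdge 4) = plaqEdge y μ' ν' i' →
      ∀ c c' : Fin 3, |(2 * β)⁻¹ * (if c = c' then (hodgeQ H)⁻¹ e e' else 0)| ≤ by_)
    (hMxy' : ∀ (e e' : LandauFree H) (i i' : Fin 4),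
      (e.1.1 : Literature.MathematicalPhysics.QuantumLattice.ZdEdge 4) = plaqEdge x μ ν i →
      (e'.1.1 : Literature.MathematicalPhysics.QuantumLattice.ZdEdge 4) = plaqEdge y μ' ν' i' →
      ∀ c c' : Fin 3, |(2 * β)⁻¹ * (if c = c' then (hodgeQ H)⁻¹ e e' else 0)| ≤ Mxy) :
    |gaussAvg β H (fun a =>
          (linCurv H (plaq12At x₀) a c₀ ^ 2 - gaussAvg β H (fun a => linCurv H (plaq12At x₀) a c₀ ^ 2)) *
          (linCurv H (plaq12At x_T) a c_T ^ 2 - gaussAvg β H (fun a => linCurv H (plaq12At x_T) a c_T ^ 2)) *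
          (tripleForm T (plaqVar H x μ ν a) * tripleForm T' (plaqVar H y μ' ν' a)))
      - gaussAvg β H (fun a =>
          (linCurv H (plaq12At x₀) a c₀ ^ 2 - gaussAvg β H (fun a => linCurv H (plaq12At x₀) a c₀ ^ 2)) *
          (linCurv H (plaq12At x_T) a c_T ^ 2 - gaussAvg β H (fun a => linCurv H (plaq12At x_T) a c_T ^ 2))) *
        gaussAvg β H (fun a => tripleForm T (plaqVar H x μ ν a) * tripleForm T' (plaqVar H y μ' ν' a))| ≤
      (384 * B) ^ 2 *
        (864 * (16 * m₀) * Mxy ^ 2 * (4 * ax * (4 * by_) + 4 * ay * (4 * bx))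
          + 324 * Mxy * (4 * ax * (4 * by_) + 4 * ay * (4 * bx)) ^ 2) := by
  classical
  -- ### the transfer to the legs process under `P_β` (✓`gaussAvg_eq_integral_pi`)
  obtain ⟨M, hMdet, htr, hleg, hcov⟩ := gaussAvg_eq_integral_pi H hβ
  set μP : Measure (Fin (Fintype.card (LandauFree H × Fin 3)) → ℝ) :=
    Measure.pi fun _ => gaussianReal 0 (Real.toNNReal (2 * β)⁻¹) with hμP
  obtain ⟨Ψ, hΨdef⟩ : ∃ Ψ : (Fin (Fintype.card (LandauFree H × Fin 3)) → ℝ) → (LandauFree H → E3),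
      Ψ = fun w => (flatten (LandauFree H)).symm fun i => (M⁻¹ *ᵥ w) (Fintype.equivFin (LandauFree H × Fin 3) i) := ⟨_, rfl⟩
  obtain ⟨X, hXdef⟩ : ∃ X : (Fin (Fintype.card (LandauFree H × Fin 3)) → ℝ) → (Fin (Fintype.card (LandauFree H × Fin 3)) → ℝ) → ℝ,
      X = fun ℓ w => ℓ ⬝ᵥ (M⁻¹ *ᵥ w) := ⟨_, rfl⟩
  obtain ⟨hat, hhat⟩ : ∃ hat : (LandauFree H × Fin 3 → ℝ) → (Fin (Fintype.card (LandauFree H × Fin 3)) → ℝ),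
      hat = fun t j => t ((Fintype.equivFin (LandauFree H × Fin 3)).symm j) := ⟨_, rfl⟩
  have hX : IsGaussianProcess X μP := by rw [hXdef]; exact isGaussianProcess_legs M β
  have hPm : IsProbabilityMeasure μP := hX.isProbabilityMeasure
  have h0 : ∀ ℓ, ∫ w, X ℓ w ∂μP = 0 := fun ℓ => by rw [hXdef]; exact integral_leg_eq_zero M β ℓ
  have htr' : ∀ F : (LandauFree H → E3) → ℝ, gaussAvg β H F = ∫ w, F (Ψ w) ∂μP := fun F => by rw [hΨdef]; exact htr F
  have hleg' : ∀ (t : LandauFree H × Fin 3 → ℝ) w, t ⬝ᵥ flatten (LandauFree H) (Ψ w) = X (hat t) w := fun t w => by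
    rw [hΨdef, hXdef, hhat]; exact hleg t w
  have hcov' : ∀ t t' : LandauFree H × Fin 3 → ℝ, ∫ w, X (hat t) w * X (hat t') w ∂μP =
      (2 * β)⁻¹ * (t ⬝ᵥ ((hodgeQ H ⊗ₖ (1 : Matrix (Fin 3) (Fin 3) ℝ))⁻¹ *ᵥ t')) := fun t t' => by
    rw [hXdef, hhat]; exact hcov t t'
  have hsymm : ∀ ℓ ℓ', ∫ w, X ℓ w * X ℓ' w ∂μP = ∫ w, X ℓ' w * X ℓ w ∂μP := fun ℓ ℓ' =>
    integral_congr_ae (ae_of_all _ fun w => by ring)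
  -- coordinates and linearised curvatures of `Ψ w` are legs
  have hΨc : ∀ w (e : LandauFree H) (c : Fin 3), (Ψ w) e c = X (hat (Pi.single (e, c) 1)) w := fun w e c => by
    rw [coord_eq_single_dotProduct_flatten, hleg']
  have hΨA : ∀ w (z : Site 4) (c : Fin 3), linCurv H (plaq12At z) (Ψ w) c =
      X (hat (fun q : LandauFree H × Fin 3 => if q.2 = c then landauCoeff H (plaq12At z) q.1 else 0)) w := fun w z c => by
    rw [linCurv_eq_dotProduct_flatten, hleg']
  -- two-point functions of coordinate legs
  have hcovsh : ∀ p q : LandauFree H × Fin 3, ∫ w, X (hat (Pi.single p 1)) w * X (hat (Pi.single q 1)) w ∂μP =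
      (2 * β)⁻¹ * (if p.2 = q.2 then (hodgeQ H)⁻¹ p.1 q.1 else 0) := fun p q => by
    rw [hcov', single_dotProduct_inv_mulVec_single (hodgeQ H) (hodgeQ_posDef H).det_pos.ne']
  -- ### the vertex expansions (✓`tripleForm_plaqVar_expansion`)
  obtain ⟨KA, _, cA, legA, hsumA, hcolA, hedgeA, hexpA⟩ := tripleForm_plaqVar_expansion H x μ ν T hT
  obtain ⟨KB, _, cB, legB, hsumB, hcolB, hedgeB, hexpB⟩ := tripleForm_plaqVar_expansion H y μ' ν' T' hT'
  -- the two curvature legs and their Wick constants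
  obtain ⟨ℓA, hℓA⟩ : ∃ ℓ, ℓ = hat (fun q : LandauFree H × Fin 3 => if q.2 = c₀ then landauCoeff H (plaq12At x₀) q.1 else 0) := ⟨_, rfl⟩
  obtain ⟨ℓB, hℓB⟩ : ∃ ℓ, ℓ = hat (fun q : LandauFree H × Fin 3 => if q.2 = c_T then landauCoeff H (plaq12At x_T) q.1 else 0) := ⟨_, rfl⟩
  have hEA : gaussAvg β H (fun a => linCurv H (plaq12At x₀) a c₀ ^ 2) = ∫ w, X ℓA w * X ℓA w ∂μP := by
    rw [htr', hℓA]; exact integral_congr_ae (ae_of_all _ fun w => by simp only [hΨA, pow_two])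
  have hEB : gaussAvg β H (fun a => linCurv H (plaq12At x_T) a c_T ^ 2) = ∫ w, X ℓB w * X ℓB w ∂μP := by
    rw [htr', hℓB]; exact integral_congr_ae (ae_of_all _ fun w => by simp only [hΨA, pow_two])
  rw [hEA, hEB]
  simp only [htr']
  -- pointwise forms of the integrands
  have hW : ∀ w, (linCurv H (plaq12At x₀) (Ψ w) c₀ ^ 2 - ∫ w, X ℓA w * X ℓA w ∂μP) *
      (linCurv H (plaq12At x_T) (Ψ w) c_T ^ 2 - ∫ w, X ℓB w * X ℓB w ∂μP) =
      (X ℓA w * X ℓA w - ∫ w, X ℓA w * X ℓA w ∂μP) * (X ℓB w * X ℓB w - ∫ w, X ℓB w * X ℓB w ∂μP) := by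
    intro w; rw [hΨA, hΨA, ← hℓA, ← hℓB, pow_two, pow_two]
  have hV : ∀ w, tripleForm T (plaqVar H x μ ν (Ψ w)) * tripleForm T' (plaqVar H y μ' ν' (Ψ w)) =
      ∑ k, ∑ k', cA k * cB k' * ∏ j : Fin 3 ⊕ Fin 3,
        X (Sum.elim (fun s => hat (Pi.single (legA k s) 1)) (fun s => hat (Pi.single (legB k' s) 1)) j) w := by
    intro w
    rw [hexpA, hexpB, Finset.sum_mul_sum]
    refine Finset.sum_congr rfl fun k _ => Finset.sum_congr rfl fun k' _ => ?_
    rw [Fintype.prod_sum_type]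
    simp only [Sum.elim_inl, Sum.elim_inr, hΨc]
    ring
  -- integrability under `P_β`
  have hintP : ∀ k k', Integrable (fun w => ∏ j : Fin 3 ⊕ Fin 3,
      X (Sum.elim (fun s => hat (Pi.single (legA k s) 1)) (fun s => hat (Pi.single (legB k' s) 1)) j) w) μP :=
    fun k k' => integrable_prod hX _ _
  have hintWP : ∀ k k', Integrable (fun w => (X ℓA w * X ℓA w - ∫ w, X ℓA w * X ℓA w ∂μP) *
      (X ℓB w * X ℓB w - ∫ w, X ℓB w * X ℓB w ∂μP) *
      ∏ j : Fin 3 ⊕ Fin 3, X (Sum.elim (fun s => hat (Pi.single (legA k s) 1)) (fun s => hat (Pi.single (legB k' s) 1)) j) w) μP := by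
    intro k k'
    have I4 := integrable_mul_mul_mul_mul_prod_of_hint (L := X) (μ := μP) (fun κ s y => integrable_prod hX s y) ℓA ℓA ℓB ℓB
      (Finset.univ : Finset (Fin 3 ⊕ Fin 3)) (Sum.elim (fun s => hat (Pi.single (legA k s) 1)) (fun s => hat (Pi.single (legB k' s) 1)))
    have I2A := integrable_mul_mul_prod_of_hint (L := X) (μ := μP) (fun κ s y => integrable_prod hX s y) ℓA ℓA
      (Finset.univ : Finset (Fin 3 ⊕ Fin 3)) (Sum.elim (fun s => hat (Pi.single (legA k s) 1)) (fun s => hat (Pi.single (legB k' s) 1)))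
    have I2B := integrable_mul_mul_prod_of_hint (L := X) (μ := μP) (fun κ s y => integrable_prod hX s y) ℓB ℓB
      (Finset.univ : Finset (Fin 3 ⊕ Fin 3)) (Sum.elim (fun s => hat (Pi.single (legA k s) 1)) (fun s => hat (Pi.single (legB k' s) 1)))
    have I0 := hintP k k'
    refine (((I4.sub (I2B.const_mul (∫ w, X ℓA w * X ℓA w ∂μP))).sub (I2A.const_mul (∫ w, X ℓB w * X ℓB w ∂μP))).add
      (I0.const_mul ((∫ w, X ℓA w * X ℓA w ∂μP) * ∫ w, X ℓB w * X ℓB w ∂μP))).congr (ae_of_all _ fun w => ?_)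
    simp only [Pi.add_apply, Pi.sub_apply]
    ring
  -- the three integrals
  have I1 : ∫ w, (linCurv H (plaq12At x₀) (Ψ w) c₀ ^ 2 - ∫ w, X ℓA w * X ℓA w ∂μP) *
        (linCurv H (plaq12At x_T) (Ψ w) c_T ^ 2 - ∫ w, X ℓB w * X ℓB w ∂μP) *
        (tripleForm T (plaqVar H x μ ν (Ψ w)) * tripleForm T' (plaqVar H y μ' ν' (Ψ w))) ∂μP =
      ∑ k, ∑ k', cA k * cB k' * ∫ w, (X ℓA w * X ℓA w - ∫ w, X ℓA w * X ℓA w ∂μP) *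
        (X ℓB w * X ℓB w - ∫ w, X ℓB w * X ℓB w ∂μP) *
        ∏ j : Fin 3 ⊕ Fin 3, X (Sum.elim (fun s => hat (Pi.single (legA k s) 1)) (fun s => hat (Pi.single (legB k' s) 1)) j) w ∂μP := by
    have hpt1 : ∀ w, (linCurv H (plaq12At x₀) (Ψ w) c₀ ^ 2 - ∫ w, X ℓA w * X ℓA w ∂μP) *
        (linCurv H (plaq12At x_T) (Ψ w) c_T ^ 2 - ∫ w, X ℓB w * X ℓB w ∂μP) *
        (tripleForm T (plaqVar H x μ ν (Ψ w)) * tripleForm T' (plaqVar H y μ' ν' (Ψ w))) =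
        ∑ k, ∑ k', cA k * cB k' * ((X ℓA w * X ℓA w - ∫ w, X ℓA w * X ℓA w ∂μP) *
          (X ℓB w * X ℓB w - ∫ w, X ℓB w * X ℓB w ∂μP) *
          ∏ j : Fin 3 ⊕ Fin 3, X (Sum.elim (fun s => hat (Pi.single (legA k s) 1)) (fun s => hat (Pi.single (legB k' s) 1)) j) w) := by
      intro w
      rw [hW, hV, Finset.mul_sum]
      refine Finset.sum_congr rfl fun k _ => ?_
      rw [Finset.mul_sum]
      exact Finset.sum_congr rfl fun k' _ => by ring
    rw [integral_congr_ae (ae_of_all _ hpt1), integral_finsetSum _ fun k _ => integrable_finsetSum _ fun k' _ => (hintWP k k').const_mul _]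
    refine Finset.sum_congr rfl fun k _ => ?_
    rw [integral_finsetSum _ fun k' _ => (hintWP k k').const_mul _]
    exact Finset.sum_congr rfl fun k' _ => integral_const_mul _ _
  have I2 : ∫ w, (linCurv H (plaq12At x₀) (Ψ w) c₀ ^ 2 - ∫ w, X ℓA w * X ℓA w ∂μP) *
        (linCurv H (plaq12At x_T) (Ψ w) c_T ^ 2 - ∫ w, X ℓB w * X ℓB w ∂μP) ∂μP =
      ∫ w, (X ℓA w * X ℓA w - ∫ w, X ℓA w * X ℓA w ∂μP) * (X ℓB w * X ℓB w - ∫ w, X ℓB w * X ℓB w ∂μP) ∂μP :=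
    integral_congr_ae (ae_of_all _ hW)
  have I3 : ∫ w, tripleForm T (plaqVar H x μ ν (Ψ w)) * tripleForm T' (plaqVar H y μ' ν' (Ψ w)) ∂μP =
      ∑ k, ∑ k', cA k * cB k' * ∫ w, ∏ j : Fin 3 ⊕ Fin 3,
        X (Sum.elim (fun s => hat (Pi.single (legA k s) 1)) (fun s => hat (Pi.single (legB k' s) 1)) j) w ∂μP := by
    rw [integral_congr_ae (ae_of_all _ hV), integral_finsetSum _ fun k _ => integrable_finsetSum _ fun k' _ => (hintP k k').const_mul _]
    refine Finset.sum_congr rfl fun k _ => ?_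
    rw [integral_finsetSum _ fun k' _ => (hintP k k').const_mul _]
    exact Finset.sum_congr rfl fun k' _ => integral_const_mul _ _
  rw [I1, I2, I3]
  -- regroup `Σ c c' ·(∫W∏) − (∫W)·Σ c c'·∫∏ = Σ c c'·(∫W∏ − ∫W·∫∏)`
  have hre : ∀ (W : ℝ) (F G : KA → KB → ℝ),
      (∑ k, ∑ k', cA k * cB k' * F k k') - W * ∑ k, ∑ k', cA k * cB k' * G k k' =
        ∑ k, ∑ k', cA k * cB k' * (F k k' - W * G k k') := by
    intro W F G
    rw [Finset.mul_sum, ← Finset.sum_sub_distrib]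
    refine Finset.sum_congr rfl fun k _ => ?_
    rw [Finset.mul_sum, ← Finset.sum_sub_distrib]
    exact Finset.sum_congr rfl fun k' _ => by ring
  rw [hre]
  -- ### apply the process-level summation (✓`abs_sum_connected_twoVertex_le`)
  have key := abs_sum_connected_twoVertex_le hX h0 cA cB (fun k s => hat (Pi.single (legA k s) 1)) (fun k s => hat (Pi.single (legB k s) 1))
    ℓA ℓB (SA := 384 * B) (SB := 384 * B) (M := Mxy) (m := 16 * m₀) (αx := 4 * ax) (αy := 4 * ay) (βx := 4 * bx) (βy := 4 * by_)
    hMxy (mul_nonneg (by norm_num) hm₀0) (mul_nonneg (by norm_num) hax0) (mul_nonneg (by norm_num) hay0)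
    (mul_nonneg (by norm_num) hbx0) (mul_nonneg (by norm_num) hby0) hsumA hsumB ?_ ?_ ?_ ?_ ?_ ?_ ?_ ?_
  · have hB2 : (384 * B) ^ 2 * (864 * (16 * m₀) * Mxy ^ 2 * (4 * ax * (4 * by_) + 4 * ay * (4 * bx))
        + 324 * Mxy * (4 * ax * (4 * by_) + 4 * ay * (4 * bx)) ^ 2) =
        (384 * B) * (384 * B) * (864 * (16 * m₀) * Mxy ^ 2 * (4 * ax * (4 * by_) + 4 * ay * (4 * bx))
        + 324 * Mxy * (4 * ax * (4 * by_) + 4 * ay * (4 * bx)) ^ 2) := by ring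
    rw [hB2]
    exact key
  · intro k hk s s' hne
    rw [hcovsh, if_neg (hcolA k s s' hne), mul_zero]
  · intro k hk s s' hne
    rw [hcovsh, if_neg (hcolB k s s' hne), mul_zero]
  · intro k k' hk hk' s s'
    rw [hcovsh]
    obtain ⟨i, hi⟩ := hedgeA k hk s
    obtain ⟨i', hi'⟩ := hedgeB k' hk' s'
    exact hMxy' _ _ i i' hi hi' _ _
  · -- `|E[X_a X_b]| ≤ 16 m₀`: contract `a` like four coordinate legs, then `b`
    rw [hℓA, hℓB, hcov']
    have h16 : |(2 * β)⁻¹ * ((fun q : LandauFree H × Fin 3 => if q.2 = c₀ then landauCoeff H (plaq12At x₀) q.1 else 0) ⬝ᵥ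
        ((hodgeQ H ⊗ₖ (1 : Matrix (Fin 3) (Fin 3) ℝ))⁻¹ *ᵥ
          (fun q : LandauFree H × Fin 3 => if q.2 = c_T then landauCoeff H (plaq12At x_T) q.1 else 0)))| ≤ 4 * (4 * m₀) := by
      refine abs_curvForm_propagator_le H hH β x₀ c₀ _ (mul_nonneg (by norm_num) hm₀0) fun i e he => ?_
      rw [← hcov', hsymm, hcov']
      refine abs_curvForm_propagator_le H hH β x_T c_T _ hm₀0 fun i' e' he' => ?_
      rw [← hcov', hsymm, hcovsh]
      exact hm₀ e e' i i' he he' _ _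
    exact h16.trans (le_of_eq (by ring))
  · intro k hk s
    rw [hℓA, hcov']
    refine abs_curvForm_propagator_le H hH β x₀ c₀ _ hax0 fun i e he => ?_
    rw [← hcov', hcovsh]
    obtain ⟨i', hi'⟩ := hedgeA k hk s
    exact hax e _ i i' he hi' _ _
  · intro k' hk' s
    rw [hℓA, hcov']
    refine abs_curvForm_propagator_le H hH β x₀ c₀ _ hay0 fun i e he => ?_
    rw [← hcov', hcovsh]
    obtain ⟨i', hi'⟩ := hedgeB k' hk' s
    exact hay e _ i i' he hi' _ _
  · intro k hk s
    rw [hℓB, hcov']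
    refine abs_curvForm_propagator_le H hH β x_T c_T _ hbx0 fun i e he => ?_
    rw [← hcov', hcovsh]
    obtain ⟨i', hi'⟩ := hedgeA k hk s
    exact hbx e _ i i' he hi' _ _
  · intro k' hk' s
    rw [hℓB, hcov']
    refine abs_curvForm_propagator_le H hH β x_T c_T _ hby0 fun i e he => ?_
    rw [← hcov', hcovsh]
    obtain ⟨i', hi'⟩ := hedgeB k' hk' s
    exact hby e _ i i' he hi' _ _

end EdgeChartGaussian

end Summit.QuantumFields.YangMills.Theorems.AllWindowsColdBoxBoxHighLine

end
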